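import Summits.CriticalPhenomena.PercolationContinuityZ3.Theorems.PercNearOneGluingNoHeavyLowerTailStarSetComonotone
import Summits.CriticalPhenomena.PercolationContinuityZ3.Theorems.PercNearOneGluingNoHeavyLowerTailStarSetForestCertificateCore
import Summits.CriticalPhenomena.PercolationContinuityZ3.Theorems.PercNearOneGluingNoHeavyLowerTailStarSetForestPointwise
import Summits.CriticalPhenomena.PercolationContinuityZ3.Theorems.PercNearOneGluingNoHeavyLowerTailStarSetLevelTwo
import HarnessLib

/-!
# `NoHeavyLowerTail` (stmt-CriticalPhenomena-4575) — the ALL-COMONOTONE word for FOREST port graphs (level `j ≤ 2`)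

Support file (prover `prim-gen-swap` gen 7; `--supports stmt-CriticalPhenomena-4575`).  No definitions, no named facts, no sorries.

`StarSet.comonotone_word_nonneg` (…StarSetComonotone) bounds the comonotone word of a two-port star family with pairwise DISTINCT ports by the
nested certificate.  This file proves the same bound when ports of different stars may coincide, provided the stars are indexed in a
LEAF-PEELING order of their port forest: `k < i → p' k ∉ {p i, p' i}` (seat memo R3-SEATS.md §9; this single hypothesis excludes parallel
stars and cycles, and holds trivially for distinct ports).  Pointwise, the forest charging certificate `StarSet.forestCertificate_core` is
instantiated with the facts of …StarSetForestPointwise (types A/B of lonely stars, budget events `Z`, `E_i`, `F_i`, exclusivity), and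
integrated exactly as in the matching case (`StarSet.linkSum_real_sub_eq_sum`, `StarSet.lightness_eq_linkSum`):

* `StarSet.comonotone_word_nonneg_forest` — `0 ≤ Σ_σ w(σ)·[μ_w(c ↮_ξ P_σ, |π_ξ(c)| ≤ j) − μ_w(c ↮_ξ P_σ, 1 ≤ |π_ξ(P_σ)| ≤ j)]` whenever `c`
  dominates the DESIGNATED ports `p i`.
-/

noncomputable section

namespace Summit.CriticalPhenomena.PercolationContinuityZ3.Theorems

open MeasureTheory Set Literature.Probability.LatticeModels Literature.Probability.Percolation
open scoped Classical BigOperators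

variable {n m : ℕ}

namespace StarSet

/-- **The comonotone word is nonnegative for FOREST port graphs (level `j ≤ 2`).**  As `StarSet.comonotone_word_nonneg`, with the
distinct-ports hypothesis replaced by the leaf-peeling hypothesis `k < i → p' k ∉ {p i, p' i}` (ports of different stars may coincide);
only the designated ports `p i` need to be dominated by `c`. [cite: VandenbergHaggstromKahn2005, Thm. 1.5 (p. 7) — only through the
domination hypothesis; the step itself is elementary] -/
theorem comonotone_word_nonneg_forest (w : Sym2 (Fin n) → unitInterval) (A : Finset (Fin n)) (s p p' : Fin m → Fin n) (c : Fin n)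
    (j : ℕ) (hj : j ≤ 2) (hs : Function.Injective s) (hsA : ∀ i, s i ∉ A) (hpA : ∀ i, p i ∈ A) (hp'A : ∀ i, p' i ∈ A)
    (hpp' : ∀ i, p i ≠ p' i) (hforest : ∀ k i, k < i → p' k ≠ p i ∧ p' k ≠ p' i) (hcA : c ∈ A)
    (hcp : ∀ i, c ≠ p i ∧ c ≠ p' i) (hwjunk : ∀ i u, u ≠ s i → u ≠ p i → u ≠ p' i → w s(s i, u) = 0)
    (hdom : ∀ i, (prodBernoulli w).real {ω : BondConfig (Fin n) | (A.filter fun z => ω ∈ openConn (p i) z).card ≤ j} ≤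
      (prodBernoulli w).real {ω : BondConfig (Fin n) | (A.filter fun z => ω ∈ openConn c z).card ≤ j}) :
    0 ≤ ∑ σ ∈ (Finset.univ : Finset (Fin m)).powerset,
      ((∏ i ∈ σ, ((w s(s i, p i) : ℝ) * w s(s i, p' i))) * ∏ i ∈ Finset.univ \ σ, (1 - (w s(s i, p i) : ℝ) * w s(s i, p' i))) *
        ((prodBernoulli w).real {ω : BondConfig (Fin n) |
            (∀ u ∈ σ.image p ∪ σ.image p', ¬ (openGraph (ω ∩ {e | ∀ v ∈ Finset.univ.image s, v ∉ e})).Reachable c u) ∧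
            (A.filter fun z => (openGraph (ω ∩ {e | ∀ v ∈ Finset.univ.image s, v ∉ e})).Reachable c z).card ≤ j} -
          (prodBernoulli w).real {ω : BondConfig (Fin n) |
            (∀ u ∈ σ.image p ∪ σ.image p', ¬ (openGraph (ω ∩ {e | ∀ v ∈ Finset.univ.image s, v ∉ e})).Reachable c u) ∧
            1 ≤ (A.filter fun z => ∃ u ∈ σ.image p ∪ σ.image p',
              (openGraph (ω ∩ {e | ∀ v ∈ Finset.univ.image s, v ∉ e})).Reachable u z).card ∧
            (A.filter fun z => ∃ u ∈ σ.image p ∪ σ.image p',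
              (openGraph (ω ∩ {e | ∀ v ∈ Finset.univ.image s, v ∉ e})).Reachable u z).card ≤ j}) := by
  have hps : ∀ i k, p i ≠ s k := fun i k h => hsA k (h ▸ hpA i)
  have hp's : ∀ i k, p' i ≠ s k := fun i k h => hsA k (h ▸ hp'A i)
  have hcs : ∀ i, c ≠ s i := fun i h => hsA i (h ▸ hcA)
  -- abbreviations: pattern weights and nested coefficients
  set θ : Fin m → ℝ := fun i => (w s(s i, p i) : ℝ) * w s(s i, p' i) with hθ
  have hθ0 : ∀ i, 0 ≤ θ i := fun i => mul_nonneg (w _).2.1 (w _).2.1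
  have hθ1 : ∀ i, θ i ≤ 1 := fun i => mul_le_one₀ (w _).2.2 (w _).2.1 (w _).2.2
  set W : Finset (Fin m) → ℝ := fun σ => (∏ i ∈ σ, θ i) * ∏ i ∈ Finset.univ \ σ, (1 - θ i) with hW
  set cf : Fin m → ℝ := fun i => θ i * ∏ k ∈ Finset.univ.filter (· < i), (1 - θ k) with hcf
  have hcf0 : ∀ i, 0 ≤ cf i := fun i => mul_nonneg (hθ0 i) (Finset.prod_nonneg fun k _ => sub_nonneg.2 (hθ1 k))
  -- the events: honest cells `D₁ ⊇?` (ρ) and `D₂` (ℓ), link-lightness `G` of `c` and `Sp i` of `p i`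
  set ξ : BondConfig (Fin n) → BondConfig (Fin n) := fun ω => ω ∩ {e | ∀ v ∈ Finset.univ.image s, v ∉ e} with hξ
  set D₁ : Finset (Fin m) → Set (BondConfig (Fin n)) := fun σ => {ω |
    (∀ u ∈ σ.image p ∪ σ.image p', ¬ (openGraph (ξ ω)).Reachable c u) ∧
      (A.filter fun z => (openGraph (ξ ω)).Reachable c z).card ≤ j} with hD₁
  set D₂ : Finset (Fin m) → Set (BondConfig (Fin n)) := fun σ => {ω |
    (∀ u ∈ σ.image p ∪ σ.image p', ¬ (openGraph (ξ ω)).Reachable c u) ∧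
      1 ≤ (A.filter fun z => ∃ u ∈ σ.image p ∪ σ.image p', (openGraph (ξ ω)).Reachable u z).card ∧
      (A.filter fun z => ∃ u ∈ σ.image p ∪ σ.image p', (openGraph (ξ ω)).Reachable u z).card ≤ j} with hD₂
  set G : Finset (Fin m) → Set (BondConfig (Fin n)) := fun σ => {ω |
    (A.filter fun z => (openGraph (ξ ω ∪ ↑(σ.image fun i => (s(p i, p' i) : Sym2 (Fin n))))).Reachable c z).card ≤ j}
    with hG
  set Sp : Fin m → Finset (Fin m) → Set (BondConfig (Fin n)) := fun i σ => {ω |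
    (A.filter fun z => (openGraph (ξ ω ∪ ↑(σ.image fun i => (s(p i, p' i) : Sym2 (Fin n))))).Reachable (p i) z).card ≤ j}
    with hSp
  -- (1) pointwise certificate
  have hpt : ∀ ω : BondConfig (Fin n),
      ∑ i, cf i * ∑ σ ∈ (Finset.univ : Finset (Fin m)).powerset, W σ * (DecisionTree.ind (G σ) ω - DecisionTree.ind (Sp i σ) ω) ≤
        ∑ σ ∈ (Finset.univ : Finset (Fin m)).powerset, W σ * (DecisionTree.ind (D₁ σ) ω - DecisionTree.ind (D₂ σ) ω) := by
    intro ω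
    -- (i) the ρ-cell is the link-lightness of `c`
    have hi : ∀ σ, DecisionTree.ind (D₁ σ) ω = DecisionTree.ind (G σ) ω := by
      intro σ
      have hΛ : ∀ l ∈ σ.image (fun i => (s(p i, p' i) : Sym2 (Fin n))),
          ∃ q q', l = s(q, q') ∧ q ≠ q' ∧ q ∈ A ∧ q' ∈ A ∧ q ≠ c ∧ q' ≠ c := by
        intro l hl
        obtain ⟨i, -, rfl⟩ := Finset.mem_image.1 hl
        exact ⟨p i, p' i, rfl, hpp' i, hpA i, hp'A i, (hcp i).1.symm, (hcp i).2.symm⟩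
      have key := sepSmall_links_iff (ξ ω) (σ.image fun i => (s(p i, p' i) : Sym2 (Fin n))) A ∅ c j hj hcA hΛ
      have hiff : ω ∈ D₁ σ ↔ ω ∈ G σ := by
        simp only [hD₁, hG, mem_setOf_eq]
        constructor
        · rintro ⟨hsep, hsmall⟩
          have h3 := key.1 ⟨fun y hy => absurd hy (Finset.notMem_empty y),
            fun l hl v hv => hsep v ((mem_portPattern_iff p p' σ v).2 ⟨l, hl, hv⟩), by convert hsmall using 4⟩
          convert h3.2 using 4
        · intro hsmall
          have h3 := key.2 ⟨fun y hy => absurd hy (Finset.notMem_empty y), by convert hsmall using 4⟩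
          refine ⟨fun u hu => ?_, by convert h3.2.2 using 4⟩
          obtain ⟨l, hl, hul⟩ := (mem_portPattern_iff p p' σ u).1 hu
          exact h3.2.1 l hl u hul
      by_cases hω : ω ∈ D₁ σ
      · rw [DecisionTree.ind_of_mem hω, DecisionTree.ind_of_mem (hiff.1 hω)]
      · rw [DecisionTree.ind_of_not_mem hω, DecisionTree.ind_of_not_mem (fun h => hω (hiff.2 h))]
    have hrhs : ∑ σ ∈ (Finset.univ : Finset (Fin m)).powerset, W σ * (DecisionTree.ind (D₁ σ) ω - DecisionTree.ind (D₂ σ) ω) =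
        ∑ σ ∈ (Finset.univ : Finset (Fin m)).powerset, W σ * (DecisionTree.ind (G σ) ω - DecisionTree.ind (D₂ σ) ω) := by
      refine Finset.sum_congr rfl fun σ _ => ?_
      rw [hi σ]
    rw [hrhs]
    -- no two stars have the same pair of ports (leaf peeling)
    have hnopar : ∀ i k : Fin m, i ≠ k → ¬ ((p k = p i ∨ p k = p' i) ∧ (p' k = p i ∨ p' k = p' i)) := by
      intro i k hik hpar
      rcases lt_or_gt_of_ne hik with h | h
      · -- i < k: p' i ∉ {p k, p' k}, but the two 2-sets coincide
        have hf := hforest i k h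
        obtain ⟨h1, h2⟩ := hpar
        rcases h1 with h1 | h1 <;> rcases h2 with h2 | h2
        · exact hpp' k (h1.trans h2.symm)
        · exact hf.2 h2.symm
        · exact hf.1 h1.symm
        · exact hpp' k (h1.trans h2.symm)
      · exact (hforest k i h).elim (fun h1 h2 => hpar.2.elim h1 h2)
    -- lonely-capability of star `i` in `ξ ω`
    have hlonelyOf : ∀ i, DecisionTree.ind (D₂ {i}) ω ≠ 0 →
        (A.filter fun z => ∃ u ∈ ({i} : Finset (Fin m)).image p ∪ ({i} : Finset (Fin m)).image p',
          (openGraph (ξ ω)).Reachable u z).card ≤ j := by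
      intro i hne
      by_cases hω : ω ∈ D₂ {i}
      · simp only [hD₂, mem_setOf_eq] at hω
        exact hω.2.2
      · exact absurd (DecisionTree.ind_of_not_mem hω) hne
    refine forestCertificate_core θ hθ0 hθ1 p p' hforest (fun σ => DecisionTree.ind (G σ) ω) (fun σ => DecisionTree.ind (D₂ σ) ω)
      (fun v σ => DecisionTree.ind {ω' : BondConfig (Fin n) |
        (A.filter fun z => (openGraph (ξ ω' ∪ ↑(σ.image fun i => (s(p i, p' i) : Sym2 (Fin n))))).Reachable v z).card ≤ j} ω)
      (fun i => DecisionTree.ind (D₂ {i}) ω ≠ 0 ∧ ¬ (openGraph (ξ ω)).Reachable (p i) (p' i))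
      (fun i => DecisionTree.ind (D₂ {i}) ω ≠ 0 ∧ (openGraph (ξ ω)).Reachable (p i) (p' i))
      (fun σ => DecisionTree.ind_nonneg _ _) ?_ (fun i => BHK2006.ind_le_one _ _) (fun v σ => DecisionTree.ind_nonneg _ _)
      ?_ ?_ ?_ ?_ ?_
    · -- (ii) only singletons are lonely
      intro σ hσ
      refine DecisionTree.ind_of_not_mem fun hω => ?_
      simp only [hD₂, mem_setOf_eq] at hω
      obtain ⟨i, rfl⟩ := portPattern_lonely_singleton' (ξ ω) A p p' σ j hj hpA hp'A hpp'
        (fun i _ k _ hik => hnopar i k hik) (hω.2.1.trans_eq (card_filter_congr fun _ _ => Iff.rfl))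
        ((card_filter_congr fun _ _ => Iff.rfl).trans_le hω.2.2)
      exact hσ i rfl
    · -- lonely stars are of type A or B
      intro i hne
      by_cases h : (openGraph (ξ ω)).Reachable (p i) (p' i)
      · exact Or.inr ⟨hne, h⟩
      · exact Or.inl ⟨hne, h⟩
    · -- type A: budget events Z and E
      rintro i ⟨hne, hA⟩
      have hl := hlonelyOf i hne
      constructor
      · intro σ hσ
        refine DecisionTree.ind_of_mem ?_
        simp only [mem_setOf_eq]
        exact (card_filter_congr fun _ _ => Iff.rfl).trans_le
          (lonely_port_light_closed (ξ ω) A p p' i σ j hj hpA hp'A hpp' ((card_filter_congr fun _ _ => Iff.rfl).trans_le hl) hA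
            (fun k hk => ⟨fun h => hσ k (Or.inl h) hk, fun h => hσ k (Or.inr h) hk⟩))
      · intro σ _ hσ
        have h2 := lonely_ports_light_adj (ξ ω) A p p' i σ j hj hpA hp'A hpp' ((card_filter_congr fun _ _ => Iff.rfl).trans_le hl) (fun k hk hki hadj => hσ k hki hadj hk)
        exact ⟨DecisionTree.ind_of_mem (by
            simp only [mem_setOf_eq]; exact (card_filter_congr fun _ _ => Iff.rfl).trans_le h2.1),
          DecisionTree.ind_of_mem (by
            simp only [mem_setOf_eq]; exact (card_filter_congr fun _ _ => Iff.rfl).trans_le h2.2)⟩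
    · -- type B: budget event F
      rintro i ⟨hne, -⟩ σ hσ
      have h2 := lonely_ports_light_adj (ξ ω) A p p' i σ j hj hpA hp'A hpp' ((card_filter_congr fun _ _ => Iff.rfl).trans_le (hlonelyOf i hne))
        (fun k hk hki hadj => hσ k hki hadj hk)
      exact ⟨DecisionTree.ind_of_mem (by
          simp only [mem_setOf_eq]; exact (card_filter_congr fun _ _ => Iff.rfl).trans_le h2.1),
        DecisionTree.ind_of_mem (by
          simp only [mem_setOf_eq]; exact (card_filter_congr fun _ _ => Iff.rfl).trans_le h2.2)⟩
    · -- types A and B never adjacent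
      rintro k i ⟨hnek, hAk⟩ ⟨hnei, hBi⟩ hadj
      exact lonely_types_exclusive (ξ ω) A p p' k i j hj hpA hp'A hpp' ((card_filter_congr fun _ _ => Iff.rfl).trans_le (hlonelyOf k hnek)) hAk hBi hadj
    · -- two type-B lonely stars never adjacent
      rintro i i' hii' ⟨hnei, hBi⟩ ⟨hnei', hBi'⟩ hadj
      have h1 := lonely_typeB_ports_subset (ξ ω) A p p' i i' j hj hpA hp'A hpp' ((card_filter_congr fun _ _ => Iff.rfl).trans_le (hlonelyOf i' hnei')) hBi hadj
      rcases lt_or_gt_of_ne hii' with h | h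
      · exact (hforest i i' h).elim (fun ha hb => h1.2.elim ha hb)
      · have hadj' : p i' = p i ∨ p i' = p' i ∨ p' i' = p i ∨ p' i' = p' i := by
          rcases hadj with h' | h' | h' | h'
          · exact Or.inl h'.symm
          · exact Or.inr (Or.inr (Or.inl h'.symm))
          · exact Or.inr (Or.inl h'.symm)
          · exact Or.inr (Or.inr (Or.inr h'.symm))
        have h2 := lonely_typeB_ports_subset (ξ ω) A p p' i' i j hj hpA hp'A hpp' ((card_filter_congr fun _ _ => Iff.rfl).trans_le (hlonelyOf i hnei)) hBi' hadj'
        exact (hforest i' i h).elim (fun ha hb => h2.2.elim ha hb)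
  -- (2) integrate
  have hwt0 : ∀ e : Sym2 (Fin n), 0 ≤ ((w e : unitInterval) : ℝ) := fun e => (w e).2.1
  have hwt1 : ∀ e : Sym2 (Fin n), ((w e : unitInterval) : ℝ) ≤ 1 := fun e => (w e).2.2
  have hlower : ∑ i, cf i * ∑ σ ∈ (Finset.univ : Finset (Fin m)).powerset,
        W σ * ((prodBernoulli w).real (G σ) - (prodBernoulli w).real (Sp i σ)) ≤
      ∑ σ ∈ (Finset.univ : Finset (Fin m)).powerset, W σ * ((prodBernoulli w).real (D₁ σ) - (prodBernoulli w).real (D₂ σ)) := by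
    rw [linkSum_real_sub_eq_sum w W D₁ D₂]
    have hl : ∑ i, cf i * ∑ σ ∈ (Finset.univ : Finset (Fin m)).powerset,
          W σ * ((prodBernoulli w).real (G σ) - (prodBernoulli w).real (Sp i σ)) =
        ∑ ω : BondConfig (Fin n), BHK2006.weight (fun e => (w e : ℝ)) ω *
          ∑ i, cf i * ∑ σ ∈ (Finset.univ : Finset (Fin m)).powerset, W σ * (DecisionTree.ind (G σ) ω - DecisionTree.ind (Sp i σ) ω) := by
      calc ∑ i, cf i * ∑ σ ∈ (Finset.univ : Finset (Fin m)).powerset,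
            W σ * ((prodBernoulli w).real (G σ) - (prodBernoulli w).real (Sp i σ))
          = ∑ i, ∑ ω : BondConfig (Fin n), cf i * (BHK2006.weight (fun e => (w e : ℝ)) ω *
              ∑ σ ∈ (Finset.univ : Finset (Fin m)).powerset, W σ * (DecisionTree.ind (G σ) ω - DecisionTree.ind (Sp i σ) ω)) := by
            refine Finset.sum_congr rfl fun i _ => ?_
            rw [linkSum_real_sub_eq_sum w W G (Sp i), Finset.mul_sum]
        _ = ∑ ω : BondConfig (Fin n), ∑ i, cf i * (BHK2006.weight (fun e => (w e : ℝ)) ω *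
              ∑ σ ∈ (Finset.univ : Finset (Fin m)).powerset, W σ * (DecisionTree.ind (G σ) ω - DecisionTree.ind (Sp i σ) ω)) :=
            Finset.sum_comm
        _ = _ := by
            refine Finset.sum_congr rfl fun ω _ => ?_
            rw [Finset.mul_sum]
            refine Finset.sum_congr rfl fun i _ => ?_
            ring
    rw [hl]
    exact Finset.sum_le_sum fun ω _ => mul_le_mul_of_nonneg_left (hpt ω) (BHK2006.weight_nonneg hwt0 hwt1 ω)
  -- (3) the lower bound is `Σ_i c_i (I_w(c) − I_w(p i)) ≥ 0`
  have hIc : (prodBernoulli w).real {ω : BondConfig (Fin n) | (A.filter fun z => ω ∈ openConn c z).card ≤ j} =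
      ∑ σ ∈ (Finset.univ : Finset (Fin m)).powerset, W σ * (prodBernoulli w).real (G σ) := by
    have h := lightness_eq_linkSum w A s p p' c j hs hps hp's hpp' hwjunk hsA hcs
    convert h using 12
    exact Iff.rfl
  have hIp : ∀ i, (prodBernoulli w).real {ω : BondConfig (Fin n) | (A.filter fun z => ω ∈ openConn (p i) z).card ≤ j} =
      ∑ σ ∈ (Finset.univ : Finset (Fin m)).powerset, W σ * (prodBernoulli w).real (Sp i σ) := by
    intro i
    have h := lightness_eq_linkSum w A s p p' (p i) j hs hps hp's hpp' hwjunk hsA (fun k => hps i k)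
    convert h using 12
    exact Iff.rfl
  have hlb : 0 ≤ ∑ i, cf i * ∑ σ ∈ (Finset.univ : Finset (Fin m)).powerset,
      W σ * ((prodBernoulli w).real (G σ) - (prodBernoulli w).real (Sp i σ)) := by
    refine Finset.sum_nonneg fun i _ => mul_nonneg (hcf0 i) ?_
    have heq : ∑ σ ∈ (Finset.univ : Finset (Fin m)).powerset, W σ * ((prodBernoulli w).real (G σ) - (prodBernoulli w).real (Sp i σ)) =
        (prodBernoulli w).real {ω : BondConfig (Fin n) | (A.filter fun z => ω ∈ openConn c z).card ≤ j} -
          (prodBernoulli w).real {ω : BondConfig (Fin n) | (A.filter fun z => ω ∈ openConn (p i) z).card ≤ j} := by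
      rw [hIc, hIp i, ← Finset.sum_sub_distrib]
      refine Finset.sum_congr rfl fun σ _ => ?_
      ring
    rw [heq]
    exact sub_nonneg.2 (hdom i)
  exact le_trans hlb hlower

end StarSet

end Summit.CriticalPhenomena.PercolationContinuityZ3.Theorems

end
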